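/-
BALABAN–IMBRIE–JAFFE 1988 (CMP 114), §5.13 p.306 [PDF 50], the sentences before (5.13.3):

  «Thus we have only trains beginning with a δ/δΦ and ending in either δ/δΦ or ℱ. The sum over pairings and the sum
  over ways of arranging the contractions combine into a sum over walks {ω_α}_{α∈π}, ω = (z₁,i₁; …; z_M,i_M)
  involving the sites in α, an element of a partition π of Γ. … The 1/2 for the δ²/δΦ² term compensates for the
  fact that we count a walk as being different from its reverse.»

STEP (iv) OF THE CONNECTED-DIAGRAM ROUTE TO (5.13.3) (corrected form, G-C2-24): THE VALUE OF ONE TRAIN.  A piece on a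
group `c` of block vertices (`BIJ88ChainRegrouping306.pieces`: a nonempty set `D` of legs of `c` differentiating the
smooth factor and a connected small contraction of the other legs of `c`), summed over the pieces on `c` and over the
sites of the vertices of `c` (the colourings `z`), acts on a smooth factor `G` as THE TRAIN OPERATOR

  `𝕋_c G = ∂_{C𝔫(c)ℱ} G + ½ Σ_{p,q} (C𝔫(c))_{pq} ∂_p∂_q G`,   `𝔫(∅) = 1`,  `𝔫(c) = Σ_{b∈c} N_b C 𝔫(c ∖ b)`

(`sum_pieces_eq_trainOp`), where `C = A⁻¹` is the covariance, `ℱ = f` the source, `N_b = M_b + M_bᵀ` the symmetrized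
matrix of the two-leg vertex `b` (`⟨Φ,e_x⟩⟨Φ,M_{b,x}⟩` summed over the site `x`), and `C𝔫(c) = Σ C N_{b₁} C N_{b₂} ⋯ C
N_{b_k} C` summed over the orderings of `c` is the print's sum over walks through the vertices of `c`: the train
`δ/δΦ C □N_{b₁}□ C ⋯ □N_{b_k}□ C (½ δ/δΦ + ℱ)`.

METHOD («trains beginning with a δ/δΦ»): a DIRECTED piece is a piece with a distinguished derivative leg `l⋆ ∈ D` (the
start of the walk; a piece with two derivative legs is read twice, weight `|D|⁻¹`, which is the print's ½).  PEELING
the start vertex `b = l⋆.blk`: its other leg is contracted to ℱ or differentiates `H` (then `c = {b}`: the one-vertex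
trains `∂_{K M C ℱ}`, `½ Σ (K M C)_{pq} ∂_p∂_q` for the two orientations `M ∈ {M_b, M_bᵀ}`), or is paired with a leg
`l′` of another vertex, and removing `b` leaves a directed piece on `c ∖ b` starting at `l′` whose start kernel has
become `K M C` (`sum_lv_pair`: summing the site of `b`).  Induction on `|c|` with a running start kernel `K`
(`directedValue_eq`).  The analysis (iterated derivatives in any order, linearity) is `BIJ88SmoothClassCalculus306`.

## Main statements

* `col`, `sum_col_insert` — colourings of a set of vertices (one site each), splitting off one vertex.
* `lv`, `sum_lv_pair` — the leg vectors `e_x`, `M_{b,x·}` and `Σ_x ⟨v_{l̄}(x), w⟩ K v_{l⋆}(x) = K Mᵒ w`.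
* `wker`, `wker_eq`, `trainOp` — the walk kernel `𝔫` and the train operator.
* `directedValue_eq` — directed pieces with start kernel `K`: value `= trainOp (K 𝔫(c))`.
* `sum_pieces_eq_trainOp` — **the pieces on `c`, summed over the sites, are the train operator `𝕋_c`.**

statement-level skeleton of published theorems with citation tags; proofs where landed; nothing here is a claim
about the Yang–Mills mass gap

PDF held: `paper:balaban1988-cmp114-bij-abelian-higgs-effective-action` (journal page = PDF page + 256).

## References

* [BalabanImbrieJaffe1988] T. Bałaban, J. Imbrie, A. Jaffe, *Effective action and cluster properties of the abelian
  Higgs model*, Comm. Math. Phys. 114 (1988) 257–315, §5.13 p.305–306.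
-/
import Literature.MathematicalPhysics.QuantumFieldTheory.BalabanImbrieJaffe1984to88.BIJ88ChainRegrouping306
import Literature.MathematicalPhysics.QuantumFieldTheory.BalabanImbrieJaffe1984to88.BIJ88TruncationConnected5133
import Literature.MathematicalPhysics.QuantumFieldTheory.BalabanImbrieJaffe1984to88.BIJ88SmoothClassCalculus306

namespace Literature.MathematicalPhysics.QuantumFieldTheory.BalabanImbrieJaffe1984to88.BIJ88TrainPieces306

open Finset Matrix Function
open scoped BigOperators
open Literature.Probability.LatticeModels (IsSetPartition mem_setPartitions colours mem_piFinset_colours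
  isSetPartition_empty_iff setPartitions_singleton)
open BIJ88PairingAllOrders5133 (smallParts mem_smallParts)
open BIJ88WickSource305 (cweight cweight_singleton cweight_pair inv_dotProduct_comm)
open BIJ88WickSourceSmooth305 (dset dset_empty)
open BIJ88TruncationConnected5133 (Leg)
open BIJ88ChainRegrouping306 (pieces mem_pieces)
open BIJ88SmoothClassCalculus306 (IsSmoothClass dset_singleton dset_congr)
open BIJ88IbpComponents312 renaming legs → plegs
open BIJ88ConnectedDiagrams312 renaming IsConn → PConn

variable {α I : Type} [Fintype α] [DecidableEq α] [Fintype I] [DecidableEq I]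

/-! ## §1  Legs of a vertex -/

/-- The other leg of the same vertex. [cite: BalabanImbrieJaffe1988, §5.13 p.306] -/
def flip (l : Leg I) : Leg I := ⟨l.blk, !l.side⟩

omit [Fintype I] [DecidableEq I] in
/-- [cite: BalabanImbrieJaffe1988, §5.13 p.306] -/
@[simp] theorem flip_blk (l : Leg I) : (flip l).blk = l.blk := rfl

omit [Fintype I] [DecidableEq I] in
/-- [cite: BalabanImbrieJaffe1988, §5.13 p.306] -/
@[simp] theorem flip_flip (l : Leg I) : flip (flip l) = l := by
  cases l
  simp [flip]

omit [Fintype I] [DecidableEq I] in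
/-- [cite: BalabanImbrieJaffe1988, §5.13 p.306] -/
theorem flip_ne (l : Leg I) : flip l ≠ l := by
  cases l with
  | mk b o =>
    simp only [flip, ne_eq, Leg.mk.injEq, true_and]
    cases o <;> decide

omit [Fintype I] [DecidableEq I] in
/-- A leg of the vertex of `l` is `l` or its flip. [cite: BalabanImbrieJaffe1988, §5.13 p.306] -/
theorem eq_or_eq_flip_of_blk_eq {l l' : Leg I} (h : l'.blk = l.blk) : l' = l ∨ l' = flip l := by
  cases l with
  | mk b o =>
    cases l' with
    | mk b' o' =>
      simp only at h
      subst h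
      cases o <;> cases o' <;> simp [flip]

/-- membership in the legs of a set of vertices. [cite: BalabanImbrieJaffe1988, §5.13 p.306] -/
theorem mem_plegs_univ {c : Finset (Finset I)} {l : Leg I} : l ∈ plegs univ Leg.blk c ↔ l.blk ∈ c := by
  rw [BIJ88IbpComponents312.mem_legs]
  simp only [mem_univ, true_and]

/-! ## §2  Colourings of a set of vertices -/

section Colourings

variable (z₀ : Finset I → α)

/-- **Colourings** of the vertices in `X`: one site per vertex of `X` (the site `x` of `⟨Φ,e_x⟩⟨Φ,M_{b,x}⟩`), a fixed
dummy site elsewhere. [cite: BalabanImbrieJaffe1988, §5.13 p.306] -/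
def col (X : Finset (Finset I)) : Finset (Finset I → α) :=
  Fintype.piFinset fun b => if b ∈ X then univ else {z₀ b}

omit [DecidableEq α] in
/-- membership in `col`. [cite: BalabanImbrieJaffe1988, §5.13 p.306] -/
theorem mem_col {X : Finset (Finset I)} {z : Finset I → α} : z ∈ col z₀ X ↔ ∀ b ∉ X, z b = z₀ b := by
  rw [col, Fintype.mem_piFinset]
  refine forall_congr' fun b => ?_
  by_cases hb : b ∈ X
  · simp [hb]
  · simp [hb]

omit [DecidableEq α] in
/-- The colourings of `BIJ88TruncationConnected5133` (indexed by `insertNone σ`) are `col σ`.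
[cite: BalabanImbrieJaffe1988, §5.13 p.306] -/
theorem piFinset_colours_eq_col (σ : Finset (Finset I)) :
    Fintype.piFinset (colours (fun _ => (univ : Finset α)) z₀ (insertNone σ)) = col z₀ σ := by
  ext z
  rw [mem_piFinset_colours, mem_col]
  simp only [some_mem_insertNone, mem_univ, imp_true_iff, true_and]

omit [DecidableEq α] in
/-- **Splitting off the site of one vertex**: `Σ_{z ∈ col(X ∪ {b})} F z = Σ_x Σ_{z ∈ col X} F(z[b ↦ x])` (`b ∉ X`).
[cite: BalabanImbrieJaffe1988, §5.13 p.306] -/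
theorem sum_col_insert {M' : Type*} [AddCommMonoid M'] {X : Finset (Finset I)} {b : Finset I} (hb : b ∉ X)
    (F : (Finset I → α) → M') :
    ∑ z ∈ col z₀ (insert b X), F z = ∑ x, ∑ z ∈ col z₀ X, F (update z b x) := by
  rw [← sum_product' (s := univ) (t := col z₀ X) (f := fun x z => F (update z b x))]
  refine (sum_nbij' (fun p => update p.2 b p.1) (fun z => (z b, update z b (z₀ b))) ?_ ?_ ?_ ?_ ?_).symm
  · intro p hp
    rw [mem_product] at hp
    rw [mem_col]
    intro b' hb'
    rw [mem_insert, not_or] at hb'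
    rw [update_of_ne hb'.1]
    exact (mem_col z₀).1 hp.2 b' hb'.2
  · intro z hz
    rw [mem_product, mem_col]
    refine ⟨mem_univ _, fun b' hb' => ?_⟩
    show update z b (z₀ b) b' = z₀ b'
    by_cases h : b' = b
    · subst h
      rw [update_self]
    · rw [update_of_ne h]
      exact (mem_col z₀).1 hz b' (by rw [mem_insert, not_or]; exact ⟨h, hb'⟩)
  · intro p hp
    rw [mem_product] at hp
    refine Prod.ext (by simp) ?_
    simp only [update_idem]
    exact update_eq_self_iff.2 ((mem_col z₀).1 hp.2 b hb).symm
  · intro z _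
    simp only [update_idem, update_eq_self_iff]
  · intro p _
    rfl

end Colourings

/-! ## §3  Leg vectors and the site sums -/

section LegVectors

variable (M : Finset I → Matrix α α ℝ)

/-- **The leg vectors of a colouring** for a family of vertex matrices `M`: the leg `⟨b,false⟩` carries `e_{z_b}`,
the leg `⟨b,true⟩` the row `M_{b,z_b·}` (`BIJ88TruncationConnected5133.lvec` is the case `M = bmat`).
[cite: BalabanImbrieJaffe1988, §5.13 p.306] -/
def lv (z : Finset I → α) (l : Leg I) : α → ℝ :=
  if l.side = true then (fun y => M l.blk (z l.blk) y) else Pi.single (z l.blk) 1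

omit [Fintype α] in
/-- `lvec = lv bmat`. [cite: BalabanImbrieJaffe1988, §5.13 p.306] -/
theorem lvec_eq_lv (blk : α → I) (Δ : Matrix α α ℝ) (s : I → ℝ) :
    BIJ88TruncationConnected5133.lvec blk Δ s = lv (BIJ88TruncationConnected5133.bmat blk Δ s) := rfl

omit [Fintype α] [Fintype I] in
/-- A leg vector sees only the site of its own vertex. [cite: BalabanImbrieJaffe1988, §5.13 p.306] -/
theorem lv_update_of_ne {z : Finset I → α} {b : Finset I} {l : Leg I} (h : l.blk ≠ b) (x : α) :
    lv M (update z b x) l = lv M z l := by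
  simp only [lv, update_of_ne h]

/-- The oriented vertex matrix: `Mᵒ = M_b` if the start leg is `⟨b,false⟩`, `M_bᵀ` if it is `⟨b,true⟩`.
[cite: BalabanImbrieJaffe1988, §5.13 p.306] -/
def sideMat (b : Finset I) (o : Bool) : Matrix α α ℝ := if o = true then (M b)ᵀ else M b

omit [Fintype α] [DecidableEq α] [Fintype I] [DecidableEq I] in
/-- `Σ_o Mᵒ = N_b := M_b + M_bᵀ`. [cite: BalabanImbrieJaffe1988, §5.13 p.306] -/
theorem sum_sideMat (b : Finset I) : ∑ o, sideMat M b o = M b + (M b)ᵀ := by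
  rw [Fintype.sum_bool]
  simp only [sideMat, if_true]
  simp [add_comm]

omit [Fintype I] in
/-- **Summing the site of a vertex along a walk**: with the start leg `l⋆ = ⟨b,o⟩` carrying the kernel `K` and its
flip contracted against `w`, `Σ_x ⟨v_{flip l⋆}(x), w⟩ K v_{l⋆}(x) = K Mᵒ w`.
[cite: BalabanImbrieJaffe1988, §5.13 p.306] -/
theorem sum_lv_pair (K : Matrix α α ℝ) (w : α → ℝ) (z : Finset I → α) (b : Finset I) (o : Bool) :
    ∑ x, (lv M (update z b x) (flip ⟨b, o⟩) ⬝ᵥ w) • (K *ᵥ lv M (update z b x) ⟨b, o⟩)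
      = (K * sideMat M b o) *ᵥ w := by
  cases o
  · -- start `e_x`, the row `M_{b,x·}` contracted against `w`
    simp only [lv, flip, sideMat, update_self, Bool.not_false, if_true, Bool.false_eq_true, if_false]
    funext p
    simp only [Finset.sum_apply, Pi.smul_apply, smul_eq_mul, mulVec, dotProduct, mul_apply, Pi.single_apply]
    simp only [mul_ite, mul_one, mul_zero, sum_ite_eq', mem_univ, if_true, sum_mul]
    rw [sum_comm]
    exact sum_congr rfl fun x _ => sum_congr rfl fun y _ => by ring
  · -- start the row `M_{b,x·}`, `e_x` contracted against `w`
    simp only [lv, flip, sideMat, update_self, Bool.not_true, if_true, Bool.false_eq_true, if_false]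
    funext p
    simp only [Finset.sum_apply, Pi.smul_apply, smul_eq_mul, mulVec, dotProduct, mul_apply, Pi.single_apply,
      transpose_apply]
    simp only [ite_mul, one_mul, zero_mul, sum_ite_eq', mem_univ, if_true]
    exact sum_congr rfl fun x _ => by ring

end LegVectors

/-! ## §4  The walk kernel and the train operator -/

section Train

/-- **The walk kernel** of a set `c` of vertices: `𝔫(∅) = 1`, `𝔫(c) = Σ_{b∈c} N_b C 𝔫(c ∖ b)`; unfolded,
`𝔫(c) = Σ_{(b₁,…,b_k) an ordering of c} N_{b₁} C N_{b₂} C ⋯ N_{b_k} C` — the sum over the walks through the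
vertices of `c` (*«the sum over ways of arranging the contractions combine into a sum over walks»*).
[cite: BalabanImbrieJaffe1988, §5.13 p.306] -/
noncomputable def wker (C : Matrix α α ℝ) (N : Finset I → Matrix α α ℝ) (c : Finset (Finset I)) : Matrix α α ℝ :=
  if c.Nonempty then ∑ b ∈ c.attach, N b.1 * C * wker C N (c.erase b.1) else 1
termination_by c.card
decreasing_by exact card_erase_lt_of_mem b.2

omit [Fintype I] in
/-- `𝔫(∅) = 1`. [cite: BalabanImbrieJaffe1988, §5.13 p.306] -/
theorem wker_empty (C : Matrix α α ℝ) (N : Finset I → Matrix α α ℝ) : wker C N ∅ = 1 := by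
  rw [wker]
  simp

omit [Fintype I] in
/-- `𝔫(c) = Σ_{b∈c} N_b C 𝔫(c ∖ b)` for `c ≠ ∅`. [cite: BalabanImbrieJaffe1988, §5.13 p.306] -/
theorem wker_eq (C : Matrix α α ℝ) (N : Finset I → Matrix α α ℝ) {c : Finset (Finset I)} (hc : c.Nonempty) :
    wker C N c = ∑ b ∈ c, N b * C * wker C N (c.erase b) := by
  rw [wker, if_pos hc]
  exact sum_attach c fun b => N b * C * wker C N (c.erase b)

/-- The second coordinate derivative `∂_p ∂_q G` (`∂_p` outermost). [cite: BalabanImbrieJaffe1988, §5.13 p.306] -/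
noncomputable def D2 (G : (α → ℝ) → ℝ) (φ : α → ℝ) (p q : α) : ℝ :=
  fderiv ℝ (fun ψ => fderiv ℝ G ψ (Pi.single q 1)) φ (Pi.single p 1)

/-- **The train operator with kernel `K`**: `𝕋_K G = ∂_{Kℱ} G + ½ Σ_{p,q} K_{pq} ∂_p∂_q G` — the train ends in the
source `ℱ = f` or in a second derivative of the smooth factor (*«ending in either δ/δΦ or ℱ … The 1/2 for the
δ²/δΦ² term compensates for the fact that we count a walk as being different from its reverse»*).
[cite: BalabanImbrieJaffe1988, §5.13 p.306] -/
noncomputable def trainOp (f : α → ℝ) (K : Matrix α α ℝ) (G : (α → ℝ) → ℝ) (φ : α → ℝ) : ℝ :=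
  fderiv ℝ G φ (K *ᵥ f) + (1/2 : ℝ) * ∑ p, ∑ q, K p q * D2 G φ p q

/-- The train operator is additive in the kernel. [cite: BalabanImbrieJaffe1988, §5.13 p.306] -/
theorem trainOp_add (f : α → ℝ) (K K' : Matrix α α ℝ) (G : (α → ℝ) → ℝ) :
    trainOp f (K + K') G = trainOp f K G + trainOp f K' G := by
  funext φ
  simp only [trainOp, add_mulVec, map_add, Matrix.add_apply, add_mul, sum_add_distrib, Pi.add_apply]
  ring

/-- The train operator of a sum of kernels. [cite: BalabanImbrieJaffe1988, §5.13 p.306] -/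
theorem trainOp_sum (f : α → ℝ) {ι : Type*} (t : Finset ι) (K : ι → Matrix α α ℝ) (G : (α → ℝ) → ℝ) :
    trainOp f (∑ i ∈ t, K i) G = ∑ i ∈ t, trainOp f (K i) G := by
  induction t using Finset.cons_induction with
  | empty =>
    funext φ
    simp [trainOp]
  | cons i t hi ih => rw [sum_cons, sum_cons, trainOp_add, ih]

end Train

/-! ## §5  Connectedness bookkeeping for peeling a vertex -/

section Conn

omit [Fintype α] [DecidableEq α] in
/-- With the ambient leg set `univ`, "inside the legs of `S`" is "owned in `S`".
[cite: BalabanImbrieJaffe1988, §5.14 p.311] -/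
theorem subset_plegs_univ_iff {S : Finset (Finset I)} {B : Finset (Leg I)} :
    B ⊆ plegs univ Leg.blk S ↔ ∀ l ∈ B, l.blk ∈ S :=
  forall₂_congr fun _ _ => mem_plegs_univ

omit [Fintype α] [DecidableEq α] in
/-- With the ambient leg set `univ`, "avoiding the legs of `S`" is "not owned in `S`".
[cite: BalabanImbrieJaffe1988, §5.14 p.311] -/
theorem disjoint_plegs_univ_iff {S : Finset (Finset I)} {B : Finset (Leg I)} :
    Disjoint B (plegs univ Leg.blk S) ↔ ∀ l ∈ B, l.blk ∉ S := by
  rw [disjoint_left]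
  exact forall₂_congr fun l _ => not_congr mem_plegs_univ

omit [Fintype α] [DecidableEq α] in
/-- Connectedness may be checked with the ambient leg set `univ`. [cite: BalabanImbrieJaffe1988, §5.14 p.311] -/
theorem isConn_iff_univ {T : Finset (Leg I)} {π : Finset (Finset (Leg I))} (h : ∀ B ∈ π, B ⊆ T)
    (c : Finset (Finset I)) :
    PConn T Leg.blk c π ↔ PConn univ Leg.blk c π :=
  BIJ88ChainRegrouping306.isConn_congr h (fun B _ => subset_univ B) c

omit [Fintype α] [DecidableEq α] [Fintype I] in
/-- Every contraction pattern is connected on a one-vertex group. [cite: BalabanImbrieJaffe1988, §5.14 p.311] -/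
theorem isConn_singleton (T : Finset (Leg I)) (b : Finset I) (π : Finset (Finset (Leg I))) :
    PConn T Leg.blk {b} π := by
  intro S hS hne _
  rw [mem_powerset] at hS
  exact (subset_singleton_iff.1 hS).resolve_left hne.ne_empty

omit [Fintype α] [DecidableEq α] in
/-- **Peeling keeps the rest connected**: removing the vertex `b`, attached to the rest only through the pair
`{l₁, l′}` (`l₁` a leg of `b`, `l′` a leg of another vertex), from a connected pattern on `c` leaves a connected
pattern on `c ∖ b`. [cite: BalabanImbrieJaffe1988, §5.13 p.306] -/
theorem isConn_erase_pair {c : Finset (Finset I)} {π : Finset (Finset (Leg I))} {b : Finset I} {l₁ l' : Leg I}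
    (h : PConn univ Leg.blk c π) (hb : b ∈ c) (hB₀ : {l₁, l'} ∈ π) (hl₁ : l₁.blk = b)
    (hl' : l'.blk ∈ c.erase b) (hother : ∀ B ∈ π, B ≠ {l₁, l'} → ∀ l ∈ B, l.blk ≠ b) :
    PConn univ Leg.blk (c.erase b) (π.erase {l₁, l'}) := by
  intro S hS hne hsplit
  rw [mem_powerset] at hS
  have hbS : b ∉ S := fun h' => notMem_erase b c (hS h')
  set S'' : Finset (Finset I) := if l'.blk ∈ S then insert b S else S with hS''
  have hsub : S ⊆ S'' := by
    rw [hS'']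
    split_ifs
    · exact subset_insert b S
    · exact Subset.rfl
  have hsplit'' : BIJ88IbpComponents312.Splits univ Leg.blk π S'' := by
    intro B hB
    by_cases hB0 : B = {l₁, l'}
    · subst hB0
      by_cases hl'S : l'.blk ∈ S
      · refine Or.inl (subset_plegs_univ_iff.2 fun l hl => ?_)
        rw [hS'', if_pos hl'S]
        rcases mem_insert.1 hl with rfl | hl
        · rw [hl₁]
          exact mem_insert_self b S
        · rw [mem_singleton] at hl
          subst hl
          exact mem_insert_of_mem hl'S
      · refine Or.inr (disjoint_plegs_univ_iff.2 fun l hl => ?_)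
        rw [hS'', if_neg hl'S]
        rcases mem_insert.1 hl with rfl | hl
        · rw [hl₁]
          exact hbS
        · rw [mem_singleton] at hl
          subst hl
          exact hl'S
    · rcases hsplit B (mem_erase.2 ⟨hB0, hB⟩) with h1 | h1
      · exact Or.inl (h1.trans (BIJ88IbpComponents312.legs_mono _ _ hsub))
      · refine Or.inr (disjoint_plegs_univ_iff.2 fun l hl hlS => ?_)
        have hlS' : l.blk ∉ S := disjoint_plegs_univ_iff.1 h1 l hl
        rw [hS''] at hlS
        split_ifs at hlS
        · rcases mem_insert.1 hlS with h2 | h2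
          · exact hother B hB hB0 l hl h2
          · exact hlS' h2
        · exact hlS' hlS
  have hS''c : S'' ⊆ c := by
    rw [hS'']
    split_ifs
    · exact insert_subset hb (hS.trans (erase_subset b c))
    · exact hS.trans (erase_subset b c)
  have hne'' : S''.Nonempty := hne.mono hsub
  have key := h S'' (mem_powerset.2 hS''c) hne'' hsplit''
  by_cases hl'S : l'.blk ∈ S
  · rw [hS'', if_pos hl'S] at key
    rw [← key, erase_insert hbS]
  · rw [hS'', if_neg hl'S] at key
    exact absurd (key ▸ hb) hbS

omit [Fintype α] [DecidableEq α] in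
/-- **Attaching a vertex by a pair keeps connectedness**: a connected pattern on `c ∖ b` plus a pair joining a leg of
`b` to a leg of `c ∖ b` is connected on `c`. [cite: BalabanImbrieJaffe1988, §5.13 p.306] -/
theorem isConn_insert_pair {c : Finset (Finset I)} {π' : Finset (Finset (Leg I))} {b : Finset I} {l₁ l' : Leg I}
    (h : PConn univ Leg.blk (c.erase b) π') (hb : b ∈ c) (hl₁ : l₁.blk = b) (hl' : l'.blk ∈ c.erase b)
    (hblk : ∀ B ∈ π', ∀ l ∈ B, l.blk ∈ c.erase b) : PConn univ Leg.blk c (insert {l₁, l'} π') := by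
  intro S hS hne hsplit
  rw [mem_powerset] at hS
  by_cases hbS : b ∈ S
  · have hl'S : l'.blk ∈ S := by
      rcases hsplit _ (mem_insert_self _ π') with h1 | h1
      · exact subset_plegs_univ_iff.1 h1 l' (by simp)
      · exact absurd (hl₁ ▸ hbS : l₁.blk ∈ S) (disjoint_plegs_univ_iff.1 h1 l₁ (by simp))
    have hl'ne : l'.blk ≠ b := ne_of_mem_erase hl'
    have hsub : S.erase b ⊆ c.erase b := erase_subset_erase b hS
    have hne' : (S.erase b).Nonempty := ⟨l'.blk, mem_erase.2 ⟨hl'ne, hl'S⟩⟩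
    have hsplit' : BIJ88IbpComponents312.Splits univ Leg.blk π' (S.erase b) := by
      intro B hB
      rcases hsplit B (mem_insert_of_mem hB) with h1 | h1
      · exact Or.inl (subset_plegs_univ_iff.2 fun l hl =>
          mem_erase.2 ⟨ne_of_mem_erase (hblk B hB l hl), subset_plegs_univ_iff.1 h1 l hl⟩)
      · exact Or.inr (disjoint_plegs_univ_iff.2 fun l hl hlS =>
          disjoint_plegs_univ_iff.1 h1 l hl (mem_of_mem_erase hlS))
    have key := h _ (mem_powerset.2 hsub) hne' hsplit'
    rw [← insert_erase hbS, key, insert_erase hb]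
  · have hsub : S ⊆ c.erase b := fun x hx => mem_erase.2 ⟨fun hxb => hbS (hxb ▸ hx), hS hx⟩
    have hsplit' : BIJ88IbpComponents312.Splits univ Leg.blk π' S := fun B hB => hsplit B (mem_insert_of_mem hB)
    have key := h _ (mem_powerset.2 hsub) hne hsplit'
    have hl'S : l'.blk ∈ S := key ▸ hl'
    rcases hsplit _ (mem_insert_self _ π') with h1 | h1
    · exact absurd (subset_plegs_univ_iff.1 h1 l₁ (by simp)) (hl₁ ▸ hbS)
    · exact absurd hl'S (disjoint_plegs_univ_iff.1 h1 l' (by simp))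

end Conn

/-! ## §6  Directed pieces and the peeling maps -/

section Peel

/-- On a piece whose group has another vertex, the flip of a derivative leg `l⋆` is paired with a leg `l′` of
ANOTHER vertex of the group (it is neither a derivative leg nor contracted to ℱ: the vertex of `l⋆` would be cut
off). [cite: BalabanImbrieJaffe1988, §5.13 p.306] -/
theorem exists_partner {c : Finset (Finset I)} {q : Finset (Leg I) × Finset (Finset (Leg I))}
    (hq : q ∈ pieces Leg.blk c) {ls : Leg I} (hls : ls ∈ q.1) (hc : (c.erase ls.blk).Nonempty) :
    flip ls ∉ q.1 ∧ ∃ l', l'.blk ≠ ls.blk ∧ l'.blk ∈ c ∧ l' ∉ q.1 ∧ {flip ls, l'} ∈ q.2 := by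
  obtain ⟨hD, -, hπ, hconn⟩ := mem_pieces.1 hq
  obtain ⟨hP, hsmall⟩ := mem_smallParts.1 hπ
  set b := ls.blk with hbdef
  have hb : b ∈ c := mem_plegs_univ.1 (hD hls)
  rw [isConn_iff_univ (fun B hB => hP.subset hB)] at hconn
  -- the vertex `b` cannot be cut off from the rest of the group
  have absurd_of : (∀ B ∈ q.2, (∀ l ∈ B, l.blk ≠ b) ∨ (∀ l ∈ B, l.blk ∉ c.erase b)) → False := by
    intro hyp
    have hsplit : BIJ88IbpComponents312.Splits univ Leg.blk q.2 (c.erase b) := by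
      intro B hB
      rcases hyp B hB with h1 | h1
      · exact Or.inl (subset_plegs_univ_iff.2 fun l hl =>
          mem_erase.2 ⟨h1 l hl, mem_plegs_univ.1 (mem_sdiff.1 (hP.subset hB hl)).1⟩)
      · exact Or.inr (disjoint_plegs_univ_iff.2 h1)
    have key := hconn _ (mem_powerset.2 (erase_subset b c)) hc hsplit
    exact notMem_erase b c (key.symm ▸ hb)
  have hblk : ∀ B ∈ q.2, ∀ l ∈ B, l.blk = b → l = flip ls := by
    intro B hB l hl hlb
    rcases eq_or_eq_flip_of_blk_eq (hlb.trans hbdef) with h1 | h1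
    · exact absurd hls (h1 ▸ (mem_sdiff.1 (hP.subset hB hl)).2)
    · exact h1
  have hflip : flip ls ∉ q.1 := by
    intro hf
    refine absurd_of fun B hB => Or.inl fun l hl hlb => ?_
    exact (mem_sdiff.1 (hP.subset hB hl)).2 (hblk B hB l hl hlb ▸ hf)
  refine ⟨hflip, ?_⟩
  have hfl : flip ls ∈ plegs univ Leg.blk c \ q.1 := mem_sdiff.2 ⟨mem_plegs_univ.2 (by rw [flip_blk]; exact hb), hflip⟩
  obtain ⟨B, hB, hflB⟩ := hP.exists_mem hfl
  have hcard := hsmall B hB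
  have hpos : 0 < B.card := card_pos.2 ⟨_, hflB⟩
  rcases Nat.lt_or_ge B.card 2 with hlt | hge
  · -- `B = {flip ls}`: the other leg goes to ℱ and `b` is cut off
    have h1 : B.card = 1 := by omega
    obtain ⟨a, ha⟩ := card_eq_one.1 h1
    have ha' : a = flip ls := by
      rw [ha, mem_singleton] at hflB
      exact hflB.symm
    subst ha'
    exfalso
    refine absurd_of fun B' hB' => ?_
    by_cases hBB : B' = B
    · subst hBB
      refine Or.inr fun l hl => ?_
      rw [ha, mem_singleton] at hl
      subst hl
      rw [flip_blk]
      exact notMem_erase b c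
    · refine Or.inl fun l hl hlb => hBB ?_
      have hl' := hblk B' hB' l hl hlb
      subst hl'
      exact hP.eq_of_mem hB' hB hl hflB
  · have h2 : B.card = 2 := le_antisymm hcard hge
    obtain ⟨x, y, hxy, hBxy⟩ := card_eq_two.1 h2
    -- the partner
    set l' := if flip ls = x then y else x with hl'def
    have hl'B : l' ∈ B := by
      rw [hl'def, hBxy]
      split_ifs <;> simp
    have hl'ne : l' ≠ flip ls := by
      rw [hl'def]
      split_ifs with h
      · rw [h]; exact hxy.symm
      · exact fun h' => h h'.symm
    have hBeq : B = {flip ls, l'} := by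
      rw [hBxy] at hflB ⊢
      rw [hl'def]
      rcases mem_insert.1 hflB with h | h
      · rw [if_pos h, h]
      · rw [mem_singleton] at h
        rw [if_neg (h ▸ hxy.symm), h, pair_comm]
    have hl'D : l' ∈ plegs univ Leg.blk c \ q.1 := hP.subset hB hl'B
    refine ⟨l', fun hlb => hl'ne (hblk B hB l' hl'B (hlb.trans hbdef.symm)), mem_plegs_univ.1 (mem_sdiff.1 hl'D).1,
      (mem_sdiff.1 hl'D).2, hBeq ▸ hB⟩

/-- The partner of a paired leg (the other leg of its block). [cite: BalabanImbrieJaffe1988, §5.13 p.306] -/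
noncomputable def partner (π : Finset (Finset (Leg I))) (l : Leg I) : Leg I :=
  if h : ∃ l', l' ≠ l ∧ ({l, l'} : Finset (Leg I)) ∈ π then h.choose else l

omit [Fintype α] [DecidableEq α] [DecidableEq I] in
/-- In a set partition the partner is THE other leg of the block. [cite: BalabanImbrieJaffe1988, §5.13 p.306] -/
theorem partner_eq {V : Finset (Leg I)} {π : Finset (Finset (Leg I))} (hP : IsSetPartition V π) {l l' : Leg I}
    (hne : l' ≠ l) (hmem : {l, l'} ∈ π) : partner π l = l' := by
  have h : ∃ l'', l'' ≠ l ∧ ({l, l''} : Finset (Leg I)) ∈ π := ⟨l', hne, hmem⟩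
  rw [partner, dif_pos h]
  obtain ⟨hne', hmem'⟩ := h.choose_spec
  have heq : ({l, h.choose} : Finset (Leg I)) = {l, l'} :=
    hP.eq_of_mem hmem' hmem (mem_insert_self _ _) (mem_insert_self _ _)
  have : h.choose ∈ ({l, l'} : Finset (Leg I)) := heq ▸ (by simp)
  rcases mem_insert.1 this with h1 | h1
  · exact absurd h1 hne'
  · exact mem_singleton.1 h1

variable (c : Finset (Finset I)) (b : Finset I) (o : Bool)

/-- The directed pieces on `c`: a piece and a distinguished derivative leg (the start of the walk).
[cite: BalabanImbrieJaffe1988, §5.13 p.306] -/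
noncomputable def dpieces : Finset (Σ _ : Finset (Leg I) × Finset (Finset (Leg I)), Leg I) :=
  (pieces Leg.blk c).sigma fun q => q.1

/-- PEELING the start vertex: the rest of the directed piece, starting at the partner of the flip of the start leg.
[cite: BalabanImbrieJaffe1988, §5.13 p.306] -/
noncomputable def peelFwd (x : Σ _ : Finset (Leg I) × Finset (Finset (Leg I)), Leg I) :
    Σ _ : Finset (Leg I) × Finset (Finset (Leg I)), Leg I :=
  ⟨(insert (partner x.1.2 (flip x.2)) (x.1.1.erase x.2), x.1.2.erase {flip x.2, partner x.1.2 (flip x.2)}),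
    partner x.1.2 (flip x.2)⟩

/-- UN-PEELING: attach the vertex `b` with start leg `⟨b,o⟩`, pairing its flip with the old start leg.
[cite: BalabanImbrieJaffe1988, §5.13 p.306] -/
noncomputable def peelBack (y : Σ _ : Finset (Leg I) × Finset (Finset (Leg I)), Leg I) :
    Σ _ : Finset (Leg I) × Finset (Finset (Leg I)), Leg I :=
  ⟨(insert ⟨b, o⟩ (y.1.1.erase y.2), insert {flip ⟨b, o⟩, y.2} y.1.2), ⟨b, o⟩⟩

variable {c b o}

/-- membership in the directed pieces. [cite: BalabanImbrieJaffe1988, §5.13 p.306] -/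
theorem mem_dpieces {x : Σ _ : Finset (Leg I) × Finset (Finset (Leg I)), Leg I} :
    x ∈ dpieces c ↔ x.1 ∈ pieces Leg.blk c ∧ x.2 ∈ x.1.1 := mem_sigma

/-- The legs of `c` are those of `c ∖ b` and the two legs of `b`. [cite: BalabanImbrieJaffe1988, §5.13 p.306] -/
theorem mem_plegs_erase {l : Leg I} : l ∈ plegs univ Leg.blk (c.erase b) ↔ l ∈ plegs univ Leg.blk c ∧ l.blk ≠ b := by
  rw [mem_plegs_univ, mem_plegs_univ, mem_erase, and_comm]

/-- The legs bookkeeping of peeling: removing the derivative leg `l⋆`, its flip and the partner `l′` from the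
non-derivative legs of `c` leaves the non-derivative legs of `c ∖ l⋆.blk` once `l′` has become a derivative leg.
[cite: BalabanImbrieJaffe1988, §5.13 p.306] -/
theorem legs_sdiff_peel (ls l' : Leg I) (E : Finset (Leg I)) :
    (plegs univ Leg.blk c \ insert ls E) \ ({flip ls, l'} : Finset (Leg I))
      = plegs univ Leg.blk (c.erase ls.blk) \ insert l' E := by
  ext l
  simp only [mem_sdiff, mem_insert, mem_singleton, not_or, mem_plegs_erase]
  constructor
  · rintro ⟨⟨hlc, hls', hlE⟩, hfl, hll'⟩
    have hlb : l.blk ≠ ls.blk := by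
      intro hlb
      rcases eq_or_eq_flip_of_blk_eq hlb with h | h
      · exact hls' h
      · exact hfl h
    exact ⟨⟨hlc, hlb⟩, hll', hlE⟩
  · rintro ⟨⟨hlc, hlb⟩, hll', hlE⟩
    exact ⟨⟨hlc, fun h => hlb (by rw [h]), hlE⟩, fun h => hlb (by rw [h, flip_blk]), hll'⟩

/-- Un-peeling gives a set partition of the non-derivative legs of `c`. [cite: BalabanImbrieJaffe1988, §5.13 p.306] -/
theorem isSetPartition_peelBack (hb : b ∈ c) {y : Σ _ : Finset (Leg I) × Finset (Finset (Leg I)), Leg I}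
    (hy : y ∈ dpieces (c.erase b)) :
    IsSetPartition (plegs univ Leg.blk c \ insert ⟨b, o⟩ (y.1.1.erase y.2)) (insert {flip ⟨b, o⟩, y.2} y.1.2) := by
  obtain ⟨hq, hl'⟩ := mem_dpieces.1 hy
  obtain ⟨hD, -, hπ, -⟩ := mem_pieces.1 hq
  obtain ⟨hP, -⟩ := mem_smallParts.1 hπ
  set l' := y.2
  set ls : Leg I := ⟨b, o⟩
  have hflD : flip ls ∉ plegs univ Leg.blk (c.erase b) := fun h => (mem_plegs_erase.1 h).2 rfl
  have hP' : IsSetPartition ((plegs univ Leg.blk c \ insert ls (y.1.1.erase l')) \ ({flip ls, l'} : Finset (Leg I)))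
      y.1.2 := by
    rw [legs_sdiff_peel, insert_erase hl']
    exact hP
  refine hP'.insert (fun l hl => ?_) ⟨flip ls, mem_insert_self _ _⟩
  rw [mem_sdiff, mem_insert, not_or, mem_erase, not_and]
  rcases mem_insert.1 hl with rfl | hl
  · exact ⟨mem_plegs_univ.2 (by rw [flip_blk]; exact hb), fun h => flip_ne ls h, fun _ h => hflD (hD h)⟩
  · rw [mem_singleton] at hl
    subst hl
    exact ⟨(mem_plegs_erase.1 (hD hl')).1, fun h => (mem_plegs_erase.1 (hD hl')).2 (by rw [h]), fun h _ => h rfl⟩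

/-- Un-peeling lands in the directed pieces on `c` with start leg `⟨b,o⟩`.
[cite: BalabanImbrieJaffe1988, §5.13 p.306] -/
theorem peelBack_mem (hb : b ∈ c) {y : Σ _ : Finset (Leg I) × Finset (Finset (Leg I)), Leg I}
    (hy : y ∈ dpieces (c.erase b)) : peelBack b o y ∈ (dpieces c).filter fun x => x.2 = ⟨b, o⟩ := by
  obtain ⟨hq, hl'⟩ := mem_dpieces.1 hy
  obtain ⟨hD, -, hπ, hconn⟩ := mem_pieces.1 hq
  obtain ⟨hP, hsmall⟩ := mem_smallParts.1 hπ
  set l' := y.2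
  set ls : Leg I := ⟨b, o⟩
  have hl'c : l'.blk ∈ c.erase b := mem_plegs_univ.1 (hD hl')
  have hflD : flip ls ∉ plegs univ Leg.blk (c.erase b) := fun h => (mem_plegs_erase.1 h).2 rfl
  have hne2 : flip ls ≠ l' := fun h => hflD (h ▸ hD hl')
  -- the new contraction pattern is a set partition of the non-derivative legs of `c`
  have hP2 := isSetPartition_peelBack (o := o) hb hy
  refine mem_filter.2 ⟨mem_dpieces.2 ⟨mem_pieces.2 ⟨?_, ⟨ls, mem_insert_self _ _⟩, ?_, ?_⟩, mem_insert_self _ _⟩, rfl⟩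
  · -- derivative legs inside the legs of `c`
    intro l hl
    rcases mem_insert.1 hl with rfl | hl
    · exact mem_plegs_univ.2 hb
    · exact (mem_plegs_erase.1 (hD (mem_of_mem_erase hl))).1
  · -- small blocks
    refine mem_smallParts.2 ⟨hP2, fun B hB => ?_⟩
    rcases mem_insert.1 hB with rfl | hB
    · rw [card_pair hne2]
    · exact hsmall B hB
  · -- connected on `c`
    show PConn (plegs univ Leg.blk c \ insert ls (y.1.1.erase l')) Leg.blk c (insert {flip ls, l'} y.1.2)
    rw [isConn_iff_univ (fun B hB => hP2.subset hB)]
    rw [isConn_iff_univ (fun B hB => hP.subset hB)] at hconn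
    exact isConn_insert_pair hconn hb rfl hl'c fun B hB l hl => mem_plegs_univ.1 (mem_sdiff.1 (hP.subset hB hl)).1

end Peel

section PeelMaps

variable {c : Finset (Finset I)} {b : Finset I} {o : Bool}

/-- Peeling lands in the directed pieces on `c ∖ b`. [cite: BalabanImbrieJaffe1988, §5.13 p.306] -/
theorem peelFwd_mem (hc : (c.erase b).Nonempty) {x : Σ _ : Finset (Leg I) × Finset (Finset (Leg I)), Leg I}
    (hx : x ∈ (dpieces c).filter fun x => x.2 = ⟨b, o⟩) : peelFwd x ∈ dpieces (c.erase b) := by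
  obtain ⟨hx, hls⟩ := mem_filter.1 hx
  obtain ⟨hq, hlsD⟩ := mem_dpieces.1 hx
  obtain ⟨hD, -, hπ, hconn⟩ := mem_pieces.1 hq
  obtain ⟨hP, hsmall⟩ := mem_smallParts.1 hπ
  have hb : x.2.blk = b := by rw [hls]
  obtain ⟨hflip, l', hl'b, hl'c, -, hB₀⟩ := exists_partner hq hlsD (hb.symm ▸ hc)
  have hne : l' ≠ flip x.2 := fun h => hl'b (by rw [h, flip_blk])
  have hl'b' : l'.blk ≠ b := fun h => hl'b (h.trans hb.symm)
  have hbc : b ∈ c := hb ▸ mem_plegs_univ.1 (hD hlsD)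
  have hpart : partner x.1.2 (flip x.2) = l' := partner_eq hP hne hB₀
  rw [peelFwd, hpart]
  have hother : ∀ B ∈ x.1.2, B ≠ {flip x.2, l'} → ∀ l ∈ B, l.blk ≠ b := by
    intro B hB hBne l hl hlb
    rcases eq_or_eq_flip_of_blk_eq (hlb.trans hb.symm) with h | h
    · exact (mem_sdiff.1 (hP.subset hB hl)).2 (h ▸ hlsD)
    · exact hBne (hP.eq_of_mem hB hB₀ hl (h ▸ mem_insert_self _ _))
  refine mem_dpieces.2 ⟨mem_pieces.2 ⟨?_, ⟨l', mem_insert_self _ _⟩, ?_, ?_⟩, mem_insert_self _ _⟩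
  · intro l hl
    rcases mem_insert.1 hl with rfl | hl
    · exact mem_plegs_erase.2 ⟨mem_plegs_univ.2 hl'c, hl'b'⟩
    · obtain ⟨hlne, hlD⟩ := mem_erase.1 hl
      refine mem_plegs_erase.2 ⟨hD hlD, fun hlb => ?_⟩
      rcases eq_or_eq_flip_of_blk_eq (hlb.trans hb.symm) with h | h
      · exact hlne h
      · exact hflip (h ▸ hlD)
  · refine mem_smallParts.2 ⟨?_, fun B hB => hsmall B (mem_of_mem_erase hB)⟩
    have h1 := hP.erase hB₀
    rw [show x.1.1 = insert x.2 (x.1.1.erase x.2) from (insert_erase hlsD).symm, legs_sdiff_peel, hb] at h1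
    exact h1
  · show PConn (plegs univ Leg.blk (c.erase b) \ insert l' (x.1.1.erase x.2)) Leg.blk (c.erase b)
      (x.1.2.erase {flip x.2, l'})
    rw [isConn_iff_univ (fun B hB => ?_)]
    · rw [isConn_iff_univ (fun B hB => hP.subset hB)] at hconn
      exact isConn_erase_pair hconn hbc hB₀ (by rw [flip_blk, hb]) (mem_erase.2 ⟨hl'b', hl'c⟩) hother
    · have h1 := hP.erase hB₀
      rw [show x.1.1 = insert x.2 (x.1.1.erase x.2) from (insert_erase hlsD).symm, legs_sdiff_peel, hb] at h1
      exact h1.subset hB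

end PeelMaps

section PeelInverse

variable {c : Finset (Finset I)} {b : Finset I} {o : Bool}

/-- Peeling then un-peeling is the identity. [cite: BalabanImbrieJaffe1988, §5.13 p.306] -/
theorem peelBack_peelFwd (hc : (c.erase b).Nonempty) {x : Σ _ : Finset (Leg I) × Finset (Finset (Leg I)), Leg I}
    (hx : x ∈ (dpieces c).filter fun x => x.2 = ⟨b, o⟩) : peelBack b o (peelFwd x) = x := by
  obtain ⟨hx', hls⟩ := mem_filter.1 hx
  obtain ⟨hq, hlsD⟩ := mem_dpieces.1 hx'
  obtain ⟨-, -, hπ, -⟩ := mem_pieces.1 hq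
  obtain ⟨hP, -⟩ := mem_smallParts.1 hπ
  have hb : x.2.blk = b := by rw [hls]
  obtain ⟨-, l', hl'b, -, hl'D, hB₀⟩ := exists_partner hq hlsD (hb.symm ▸ hc)
  have hne : l' ≠ flip x.2 := fun h => hl'b (by rw [h, flip_blk])
  have hpart : partner x.1.2 (flip x.2) = l' := partner_eq hP hne hB₀
  obtain ⟨⟨D, π⟩, ls⟩ := x
  simp only at hls hlsD hl'D hB₀ hpart ⊢
  subst hls
  rw [peelFwd, peelBack]
  simp only [hpart]
  congr 2
  · rw [erase_insert (fun h => hl'D (mem_of_mem_erase h)), insert_erase hlsD]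
  · rw [insert_erase hB₀]

/-- Un-peeling then peeling is the identity. [cite: BalabanImbrieJaffe1988, §5.13 p.306] -/
theorem peelFwd_peelBack (hb : b ∈ c) {y : Σ _ : Finset (Leg I) × Finset (Finset (Leg I)), Leg I}
    (hy : y ∈ dpieces (c.erase b)) : peelFwd (peelBack b o y) = y := by
  have hP2 := isSetPartition_peelBack (o := o) hb hy
  obtain ⟨hq, hl'⟩ := mem_dpieces.1 hy
  obtain ⟨hD, -, hπ, -⟩ := mem_pieces.1 hq
  obtain ⟨hP, -⟩ := mem_smallParts.1 hπ
  have hflD : flip (⟨b, o⟩ : Leg I) ∉ plegs univ Leg.blk (c.erase b) := fun h => (mem_plegs_erase.1 h).2 rfl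
  have hne2 : y.2 ≠ flip ⟨b, o⟩ := fun h => hflD (h ▸ hD hl')
  have hpart : partner (insert {flip ⟨b, o⟩, y.2} y.1.2) (flip ⟨b, o⟩) = y.2 :=
    partner_eq hP2 hne2 (mem_insert_self _ _)
  have hls : (⟨b, o⟩ : Leg I) ∉ y.1.1.erase y.2 := fun h => (mem_plegs_erase.1 (hD (mem_of_mem_erase h))).2 rfl
  have hB₀ : {flip ⟨b, o⟩, y.2} ∉ y.1.2 := fun h => hflD (mem_sdiff.1 (hP.subset h (mem_insert_self _ _))).1
  obtain ⟨⟨D, π⟩, l'⟩ := y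
  simp only at hpart hls hB₀ hl' ⊢
  rw [peelBack, peelFwd]
  simp only [hpart]
  congr 2
  · rw [erase_insert hls, insert_erase hl']
  · rw [erase_insert hB₀]

end PeelInverse

/-! ## §7  The value of a directed piece; peeling the start vertex sums its site -/

section Value

variable (A : Matrix α α ℝ) (f : α → ℝ) (M : Finset I → Matrix α α ℝ) (z₀ : Finset I → α)

/-- The directions of the derivative legs of a directed piece: `C v_l`, except the start kernel `K v_{l⋆}` at the
start leg. [cite: BalabanImbrieJaffe1988, §5.13 p.306] -/
noncomputable def dir (K : Matrix α α ℝ) (z : Finset I → α) (ls : Leg I) (l : Leg I) : α → ℝ :=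
  (if l = ls then K else A⁻¹) *ᵥ lv M z l

/-- **The value of a directed piece** `x = ((D, π), l⋆)` on `c` with start kernel `K`, acting on the smooth factor
`G`, summed over the sites of the vertices of `c`: `|D|⁻¹ Σ_z (Π_{B∈π} w_B(z)) ∂_{dir_D} G` (the weight `|D|⁻¹`
is `1` for a train ending in ℱ and the print's `½` for a train read from both its ends).
[cite: BalabanImbrieJaffe1988, §5.13 p.306] -/
noncomputable def dvalue (K : Matrix α α ℝ) (c : Finset (Finset I)) (G : (α → ℝ) → ℝ)
    (x : Σ _ : Finset (Leg I) × Finset (Finset (Leg I)), Leg I) : (α → ℝ) → ℝ :=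
  (x.1.1.card : ℝ)⁻¹ • ∑ z ∈ col z₀ c, (∏ B ∈ x.1.2, cweight A f (lv M z) B) • dset (dir A M K z x.2) x.1.1 G

/-- The sum of the values of the directed pieces on `c` with start kernel `K`.
[cite: BalabanImbrieJaffe1988, §5.13 p.306] -/
noncomputable def directedValue (K : Matrix α α ℝ) (c : Finset (Finset I)) (G : (α → ℝ) → ℝ) : (α → ℝ) → ℝ :=
  ∑ x ∈ dpieces c, dvalue A f M z₀ K c G x

variable {A M}

omit [DecidableEq I] in
/-- [cite: BalabanImbrieJaffe1988, §5.13 p.306] -/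
@[simp] theorem dir_self (K : Matrix α α ℝ) (z : Finset I → α) (ls : Leg I) : dir A M K z ls ls = K *ᵥ lv M z ls := by
  simp [dir]

omit [DecidableEq I] in
/-- [cite: BalabanImbrieJaffe1988, §5.13 p.306] -/
theorem dir_of_ne (K : Matrix α α ℝ) (z : Finset I → α) {ls l : Leg I} (h : l ≠ ls) :
    dir A M K z ls l = A⁻¹ *ᵥ lv M z l := by
  simp [dir, h]

omit [Fintype I] [DecidableEq I] in
/-- `⟨Cx, y⟩ = ⟨x, Cy⟩`. [cite: BalabanImbrieJaffe1988, §5.13 p.305] -/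
theorem inv_mulVec_dotProduct_comm (hA : A.PosDef) (x y : α → ℝ) : (A⁻¹ *ᵥ x) ⬝ᵥ y = x ⬝ᵥ (A⁻¹ *ᵥ y) := by
  rw [inv_dotProduct_comm hA, dotProduct_comm]

variable (A) in
omit [Fintype I] [DecidableEq I] in
/-- A contraction weight sees only the vectors of its own legs. [cite: BalabanImbrieJaffe1988, §5.13 p.305] -/
theorem cweight_congr {κ : Type} [DecidableEq κ] {v v' : κ → α → ℝ} {B : Finset κ} (h : ∀ i ∈ B, v i = v' i) :
    cweight A f v B = cweight A f v' B := by
  simp only [cweight]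
  congr 1
  · exact sum_congr rfl fun i hi => by rw [h i hi]
  · congr 1
    exact sum_congr rfl fun i hi => sum_congr rfl fun j hj => by rw [h i hi, h j (mem_of_mem_erase hj)]

variable (M) in
omit [Fintype I] in
/-- The site sum of the start vertex, entrywise: `Σ_x (K v_{l⋆}(x))_p (C v_{flip l⋆}(x))_q = (K Mᵒ C)_{pq}` for `C`
symmetric. [cite: BalabanImbrieJaffe1988, §5.13 p.306] -/
theorem sum_lv_pair_entry {C : Matrix α α ℝ} (hC : Cᵀ = C) (K : Matrix α α ℝ) (z : Finset I → α) (b : Finset I)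
    (o : Bool) (p q : α) :
    ∑ x, (K *ᵥ lv M (update z b x) ⟨b, o⟩) p * (C *ᵥ lv M (update z b x) (flip ⟨b, o⟩)) q
      = (K * sideMat M b o * C) p q := by
  have h := congrFun (sum_lv_pair M K (fun y => C q y) z b o) p
  simp only [Finset.sum_apply, Pi.smul_apply, smul_eq_mul] at h
  have e1 : ∀ x, (C *ᵥ lv M (update z b x) (flip ⟨b, o⟩)) q = lv M (update z b x) (flip ⟨b, o⟩) ⬝ᵥ fun y => C q y :=
    fun x => dotProduct_comm _ _
  simp only [e1]
  rw [show (∑ x, (K *ᵥ lv M (update z b x) ⟨b, o⟩) p * (lv M (update z b x) (flip ⟨b, o⟩) ⬝ᵥ fun y => C q y))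
      = ∑ x, (lv M (update z b x) (flip ⟨b, o⟩) ⬝ᵥ fun y => C q y) * (K *ᵥ lv M (update z b x) ⟨b, o⟩) p from
    sum_congr rfl fun x _ => mul_comm _ _, h, Matrix.mul_apply]
  simp only [mulVec, dotProduct]
  exact sum_congr rfl fun y _ => by rw [show C q y = C y q from by rw [← hC, transpose_apply, hC]]

omit [DecidableEq α] in
/-- Colourings of a single vertex: its site. [cite: BalabanImbrieJaffe1988, §5.13 p.306] -/
theorem sum_col_singleton {M' : Type*} [AddCommMonoid M'] (b : Finset I) (F : (Finset I → α) → M') :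
    ∑ z ∈ col z₀ {b}, F z = ∑ x, F (update z₀ b x) := by
  have hcol : col z₀ (∅ : Finset (Finset I)) = {z₀} := by
    ext z
    rw [mem_col, mem_singleton]
    exact ⟨fun h => funext fun b => h b (notMem_empty b), fun h b _ => by rw [h]⟩
  rw [← Finset.insert_empty, sum_col_insert z₀ (notMem_empty b)]
  simp only [hcol, sum_singleton]

/-- **PEELING SUMS THE SITE OF THE START VERTEX**: the value of the un-peeled directed piece (start leg `⟨b,o⟩`,
kernel `K`) is the value of the directed piece on `c ∖ b` with start kernel `K Mᵒ C`.
[cite: BalabanImbrieJaffe1988, §5.13 p.306] -/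
theorem dvalue_peelBack {𝒞 : Submodule ℝ ((α → ℝ) → ℝ)} (h𝒞 : IsSmoothClass 𝒞) (hA : A.PosDef)
    {c : Finset (Finset I)} {b : Finset I} (hb : b ∈ c) (o : Bool) (K : Matrix α α ℝ) {G : (α → ℝ) → ℝ}
    (hG : G ∈ 𝒞) {y : Σ _ : Finset (Leg I) × Finset (Finset (Leg I)), Leg I} (hy : y ∈ dpieces (c.erase b)) :
    dvalue A f M z₀ K c G (peelBack b o y) = dvalue A f M z₀ (K * sideMat M b o * A⁻¹) (c.erase b) G y := by
  obtain ⟨hq, hl'⟩ := mem_dpieces.1 hy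
  obtain ⟨hD, -, hπ, -⟩ := mem_pieces.1 hq
  obtain ⟨hP, -⟩ := mem_smallParts.1 hπ
  obtain ⟨⟨D', π'⟩, l'⟩ := y
  simp only at hD hP hl'
  have hl'b : l'.blk ≠ b := (mem_plegs_erase.1 (hD hl')).2
  have hlsE : (⟨b, o⟩ : Leg I) ∉ D'.erase l' := fun h => (mem_plegs_erase.1 (hD (mem_of_mem_erase h))).2 rfl
  have hl'E : l' ∉ D'.erase l' := notMem_erase l' D'
  have hflD : flip (⟨b, o⟩ : Leg I) ∉ plegs univ Leg.blk (c.erase b) := fun h => (mem_plegs_erase.1 h).2 rfl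
  have hne2 : flip ⟨b, o⟩ ≠ l' := fun h => hflD (h ▸ hD hl')
  have hB₀ : {flip ⟨b, o⟩, l'} ∉ π' := fun h => hflD (mem_sdiff.1 (hP.subset h (mem_insert_self _ _))).1
  have hEb : ∀ l ∈ D'.erase l', l.blk ≠ b := fun l hl => (mem_plegs_erase.1 (hD (mem_of_mem_erase hl))).2
  have hπb : ∀ B ∈ π', ∀ l ∈ B, l.blk ≠ b := fun B hB l hl =>
    (mem_plegs_erase.1 (mem_sdiff.1 (hP.subset hB hl)).1).2
  rw [dvalue, dvalue, peelBack]
  dsimp only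
  -- `|D|`
  have hD' : D' = insert l' (D'.erase l') := (insert_erase hl').symm
  have hcard : (insert (⟨b, o⟩ : Leg I) (D'.erase l')).card = D'.card := by
    rw [card_insert_of_notMem hlsE, card_erase_add_one hl']
  rw [hcard]
  congr 1
  -- colourings of `c` = site of `b` × colourings of `c ∖ b`
  rw [show col z₀ c = col z₀ (insert b (c.erase b)) by rw [insert_erase hb], sum_col_insert z₀ (notMem_erase b c),
    sum_comm]
  refine sum_congr rfl fun z _ => ?_
  -- the directions away from the start leg do not see the site of `b`
  have hu₀ : ∀ x, ∀ l ∈ D'.erase l', dir A M K (update z b x) ⟨b, o⟩ l = dir A M (K * sideMat M b o * A⁻¹) z l' l := by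
    intro x l hl
    have h1 : l ≠ ⟨b, o⟩ := fun h => hlsE (h ▸ hl)
    rw [dir_of_ne _ _ h1, dir_of_ne _ _ (ne_of_mem_erase hl), lv_update_of_ne M (hEb l hl)]
  have step : ∀ x : α,
      (∏ B ∈ insert {flip ⟨b, o⟩, l'} π', cweight A f (lv M (update z b x)) B) •
          dset (dir A M K (update z b x) ⟨b, o⟩) (insert ⟨b, o⟩ (D'.erase l')) G
        = (∏ B ∈ π', cweight A f (lv M z) B) •
          ((lv M (update z b x) (flip ⟨b, o⟩) ⬝ᵥ (A⁻¹ *ᵥ lv M z l')) •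
            dset (dir A M (K * sideMat M b o * A⁻¹) z l') (D'.erase l')
              (fun φ => fderiv ℝ G φ (K *ᵥ lv M (update z b x) ⟨b, o⟩))) := by
    intro x
    rw [prod_insert hB₀, cweight_pair hA f _ hne2, inv_mulVec_dotProduct_comm hA, lv_update_of_ne M hl'b,
      prod_congr rfl fun B hB => cweight_congr A f fun l hl => lv_update_of_ne M (hπb B hB l hl) x,
      h𝒞.dset_insert _ hlsE hG, dset_congr (hu₀ x), dir_self, mul_comm, mul_smul]
  rw [sum_congr rfl fun x _ => step x, ← smul_sum]
  congr 1
  -- linearity in the direction of the start leg and the site sum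
  have hmem : ∀ x : α, (fun φ => fderiv ℝ G φ (K *ᵥ lv M (update z b x) ⟨b, o⟩)) ∈ 𝒞 := fun x =>
    h𝒞.fderiv_mem G hG _
  have hlin : (∑ x, (lv M (update z b x) (flip ⟨b, o⟩) ⬝ᵥ (A⁻¹ *ᵥ lv M z l')) •
        fun φ => fderiv ℝ G φ (K *ᵥ lv M (update z b x) ⟨b, o⟩))
      = fun φ => fderiv ℝ G φ ((K * sideMat M b o * A⁻¹) *ᵥ lv M z l') := by
    funext φ
    simp only [Finset.sum_apply, Pi.smul_apply, smul_eq_mul]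
    rw [← mulVec_mulVec, ← sum_lv_pair M K (A⁻¹ *ᵥ lv M z l') z b o, map_sum]
    exact sum_congr rfl fun x _ => by rw [map_smul, smul_eq_mul]
  conv_rhs => rw [hD', h𝒞.dset_insert _ hl'E hG, dir_self]
  rw [← hlin, h𝒞.dset_sum _ _ univ _ fun x _ => Submodule.smul_mem 𝒞 _ (hmem x)]
  exact sum_congr rfl fun x _ => (h𝒞.dset_smul _ _ _ (hmem x)).symm

end Value

/-! ## §8  One-vertex trains, the fibre sums, and the induction -/

section Induction

variable (A : Matrix α α ℝ) (f : α → ℝ) (M : Finset I → Matrix α α ℝ) (z₀ : Finset I → α)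

omit [Fintype α] [DecidableEq α] in
/-- The two legs of a vertex. [cite: BalabanImbrieJaffe1988, §5.13 p.306] -/
theorem plegs_univ_singleton (b : Finset I) (o : Bool) :
    plegs univ Leg.blk {b} = {(⟨b, o⟩ : Leg I), flip ⟨b, o⟩} := by
  ext l
  rw [mem_plegs_univ, mem_singleton, mem_insert, mem_singleton]
  constructor
  · intro h
    exact eq_or_eq_flip_of_blk_eq h
  · rintro (rfl | rfl)
    · rfl
    · rfl

omit [Fintype α] [DecidableEq α] in
/-- **The directed pieces on one vertex** with start leg `l⋆ = ⟨b,o⟩`: the FH train `({l⋆}, {{flip l⋆}})` (the other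
leg contracts to ℱ) and the HH train `({l⋆, flip l⋆}, ∅)` (both legs differentiate the smooth factor).
[cite: BalabanImbrieJaffe1988, §5.13 p.306] -/
theorem fibre_singleton (b : Finset I) (o : Bool) :
    (dpieces {b}).filter (fun x => x.2 = ⟨b, o⟩)
      = {⟨({⟨b, o⟩}, {{flip ⟨b, o⟩}}), ⟨b, o⟩⟩, ⟨({⟨b, o⟩, flip ⟨b, o⟩}, ∅), ⟨b, o⟩⟩} := by
  have hne : (⟨b, o⟩ : Leg I) ≠ flip ⟨b, o⟩ := (flip_ne _).symm
  have hL := plegs_univ_singleton b o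
  ext x
  rw [mem_filter, mem_dpieces, mem_pieces, mem_insert, mem_singleton]
  constructor
  · rintro ⟨⟨⟨hD, -, hπ, -⟩, hls⟩, hx2⟩
    obtain ⟨⟨D, π⟩, ls⟩ := x
    simp only at hD hπ hls hx2 ⊢
    subst hx2
    rw [hL] at hD hπ
    have hP := (mem_smallParts.1 hπ).1
    by_cases hf : flip ⟨b, o⟩ ∈ D
    · right
      have hDeq : D = {⟨b, o⟩, flip ⟨b, o⟩} := Subset.antisymm hD (insert_subset hls (singleton_subset_iff.2 hf))
      subst hDeq
      rw [Finset.sdiff_self, isSetPartition_empty_iff] at hP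
      subst hP
      rfl
    · left
      have hDeq : D = {⟨b, o⟩} := by
        refine Subset.antisymm (fun l hl => ?_) (singleton_subset_iff.2 hls)
        rcases mem_insert.1 (hD hl) with h | h
        · rw [h, mem_singleton]
        · rw [mem_singleton] at h
          exact absurd (h ▸ hl) hf
      subst hDeq
      have hsd : ({(⟨b, o⟩ : Leg I), flip ⟨b, o⟩} : Finset (Leg I)) \ {⟨b, o⟩} = {flip ⟨b, o⟩} := by
        rw [insert_sdiff_of_mem _ (mem_singleton_self _), sdiff_singleton_eq_erase, erase_eq_of_notMem]
        rw [mem_singleton]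
        exact hne
      rw [hsd] at hP
      have hπeq : π = {{flip ⟨b, o⟩}} := by
        have := mem_setPartitions.2 hP
        rwa [setPartitions_singleton, mem_singleton] at this
      subst hπeq
      rfl
  · rintro (rfl | rfl)
    · dsimp only
      refine ⟨⟨⟨by rw [hL]; exact singleton_subset_iff.2 (mem_insert_self _ _), ⟨_, mem_singleton_self _⟩, ?_,
        isConn_singleton _ _ _⟩, mem_singleton_self _⟩, rfl⟩
      rw [hL, insert_sdiff_of_mem _ (mem_singleton_self _), sdiff_singleton_eq_erase, erase_eq_of_notMem
        (by rw [mem_singleton]; exact hne), mem_smallParts]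
      refine ⟨mem_setPartitions.1 ?_, fun B hB => ?_⟩
      · rw [setPartitions_singleton]
        exact mem_singleton_self _
      · rw [mem_singleton] at hB
        rw [hB, card_singleton]
        norm_num
    · dsimp only
      refine ⟨⟨⟨by rw [hL], ⟨_, mem_insert_self _ _⟩, ?_, isConn_singleton _ _ _⟩, mem_insert_self _ _⟩, rfl⟩
      rw [hL, Finset.sdiff_self, mem_smallParts, isSetPartition_empty_iff]
      exact ⟨rfl, fun B hB => (notMem_empty B hB).elim⟩

/-- **The one-vertex trains**: `∂_{K Mᵒ C ℱ} G + ½ Σ_{pq} (K Mᵒ C)_{pq} ∂_p∂_q G = 𝕋_{K Mᵒ C} G`.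
[cite: BalabanImbrieJaffe1988, §5.13 p.306] -/
theorem sum_fibre_singleton {𝒞 : Submodule ℝ ((α → ℝ) → ℝ)} (h𝒞 : IsSmoothClass 𝒞) (hA : A.PosDef)
    (b : Finset I) (o : Bool) (K : Matrix α α ℝ) {G : (α → ℝ) → ℝ} (hG : G ∈ 𝒞) :
    ∑ x ∈ (dpieces {b}).filter (fun x => x.2 = ⟨b, o⟩), dvalue A f M z₀ K {b} G x
      = trainOp f (K * sideMat M b o * A⁻¹) G := by
  have hne : (⟨b, o⟩ : Leg I) ≠ flip ⟨b, o⟩ := (flip_ne _).symm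
  have hsym : (A⁻¹)ᵀ = A⁻¹ := by
    rw [transpose_nonsing_inv, (BIJ88IntegrationByParts305.isSymm_of_posDef hA).eq]
  have hx : (⟨({⟨b, o⟩}, {{flip ⟨b, o⟩}}), ⟨b, o⟩⟩ : Σ _ : Finset (Leg I) × Finset (Finset (Leg I)), Leg I)
      ≠ ⟨({⟨b, o⟩, flip ⟨b, o⟩}, ∅), ⟨b, o⟩⟩ := by
    intro h
    have h1 := congrArg (fun x => x.1.2) h
    simp only at h1
    exact singleton_ne_empty _ h1
  rw [fibre_singleton, sum_pair hx, dvalue, dvalue]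
  dsimp only
  rw [card_singleton, card_pair hne, Nat.cast_one, inv_one, one_smul, Nat.cast_ofNat, sum_col_singleton,
    sum_col_singleton]
  have hF : ∀ x, dset (dir A M K (update z₀ b x) ⟨b, o⟩) {⟨b, o⟩} G
      = fun φ => fderiv ℝ G φ (K *ᵥ lv M (update z₀ b x) ⟨b, o⟩) := fun x => by
    rw [dset_singleton, dir_self]
  have hH : ∀ x, dset (dir A M K (update z₀ b x) ⟨b, o⟩) {⟨b, o⟩, flip ⟨b, o⟩} G
      = fun φ => fderiv ℝ (fun ψ => fderiv ℝ G ψ (A⁻¹ *ᵥ lv M (update z₀ b x) (flip ⟨b, o⟩))) φ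
          (K *ᵥ lv M (update z₀ b x) ⟨b, o⟩) := fun x => by
    rw [h𝒞.dset_pair _ hne hG, dir_self, dir_of_ne _ _ hne.symm]
  simp only [prod_singleton, prod_empty]
  simp only [cweight_singleton]
  simp only [hF, hH]
  simp only [one_smul]
  funext φ
  simp only [trainOp, Pi.add_apply, Finset.sum_apply, Pi.smul_apply, smul_eq_mul]
  congr 1
  · -- the train ending in ℱ
    rw [← mulVec_mulVec, ← sum_lv_pair M K (A⁻¹ *ᵥ f) z₀ b o, map_sum]
    exact sum_congr rfl fun x _ => by rw [map_smul, smul_eq_mul, inv_mulVec_dotProduct_comm hA]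
  · -- the train ending in a second derivative of the smooth factor
    rw [one_div, sum_congr rfl fun x _ => h𝒞.fderiv_fderiv_eq_sum hG _ _ φ]
    congr 1
    simp only [D2]
    conv_lhs => rw [sum_comm]
    refine sum_congr rfl fun p _ => ?_
    conv_lhs => rw [sum_comm]
    refine sum_congr rfl fun q _ => ?_
    rw [← sum_mul, sum_lv_pair_entry M hsym K z₀ b o p q]

/-- The fibre of the start leg `⟨b,o⟩`, when the group has another vertex: the directed pieces on `c ∖ b` with start
kernel `K Mᵒ C`. [cite: BalabanImbrieJaffe1988, §5.13 p.306] -/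
theorem sum_fibre_eq_directedValue {𝒞 : Submodule ℝ ((α → ℝ) → ℝ)} (h𝒞 : IsSmoothClass 𝒞) (hA : A.PosDef)
    {c : Finset (Finset I)} {b : Finset I} (hb : b ∈ c) (hc : (c.erase b).Nonempty) (o : Bool)
    (K : Matrix α α ℝ) {G : (α → ℝ) → ℝ} (hG : G ∈ 𝒞) :
    ∑ x ∈ (dpieces c).filter (fun x => x.2 = ⟨b, o⟩), dvalue A f M z₀ K c G x
      = directedValue A f M z₀ (K * sideMat M b o * A⁻¹) (c.erase b) G := by
  rw [directedValue]
  exact (sum_nbij' (peelBack b o) peelFwd (fun y hy => peelBack_mem hb hy) (fun x hx => peelFwd_mem hc hx)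
    (fun y hy => peelFwd_peelBack hb hy) (fun x hx => peelBack_peelFwd hc hx)
    (fun y hy => (dvalue_peelBack f z₀ h𝒞 hA hb o K hG hy).symm)).symm

omit [Fintype α] [DecidableEq α] in
/-- Summing over the legs of `c` = over its vertices and the two sides. [cite: BalabanImbrieJaffe1988, §5.13 p.306] -/
theorem sum_plegs_univ {M' : Type*} [AddCommMonoid M'] (c : Finset (Finset I)) (g : Leg I → M') :
    ∑ l ∈ plegs univ Leg.blk c, g l = ∑ b ∈ c, ∑ o : Bool, g ⟨b, o⟩ := by
  rw [← sum_product' c univ fun b o => g ⟨b, o⟩]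
  refine sum_nbij' (fun l => (l.blk, l.side)) (fun p => ⟨p.1, p.2⟩) (fun l hl => ?_) (fun p hp => ?_)
    (fun l _ => rfl) (fun p _ => rfl) (fun l _ => rfl)
  · exact mem_product.2 ⟨mem_plegs_univ.1 hl, mem_univ _⟩
  · exact mem_plegs_univ.2 (mem_product.1 hp).1

/-- The directed pieces grouped by their start leg. [cite: BalabanImbrieJaffe1988, §5.13 p.306] -/
theorem directedValue_fiberwise (K : Matrix α α ℝ) (c : Finset (Finset I)) (G : (α → ℝ) → ℝ) :
    directedValue A f M z₀ K c G
      = ∑ b ∈ c, ∑ o : Bool, ∑ x ∈ (dpieces c).filter (fun x => x.2 = ⟨b, o⟩), dvalue A f M z₀ K c G x := by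
  rw [directedValue, ← sum_fiberwise_of_maps_to (t := plegs univ Leg.blk c) (g := fun x => x.2) fun x hx => ?_,
    sum_plegs_univ]
  obtain ⟨hq, hl⟩ := mem_dpieces.1 hx
  exact (mem_pieces.1 hq).1 hl

/-- **THE DIRECTED PIECES ON `c` WITH START KERNEL `K` ARE THE TRAIN OPERATOR `𝕋_{K𝔫(c)}`** — by peeling the start
vertex (`sum_fibre_eq_directedValue`, `sum_fibre_singleton`) and induction on the group, the recursion of the walk
kernel `𝔫(c) = Σ_b N_b C 𝔫(c ∖ b)` appearing as the sum over the start vertex `b` and its two orientations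
(`Σ_o Mᵒ = N_b`). [cite: BalabanImbrieJaffe1988, §5.13 p.306] -/
theorem directedValue_eq {𝒞 : Submodule ℝ ((α → ℝ) → ℝ)} (h𝒞 : IsSmoothClass 𝒞) (hA : A.PosDef)
    (c : Finset (Finset I)) :
    c.Nonempty → ∀ (K : Matrix α α ℝ) {G : (α → ℝ) → ℝ}, G ∈ 𝒞 →
      directedValue A f M z₀ K c G = trainOp f (K * wker A⁻¹ (fun b => M b + (M b)ᵀ) c) G := by
  induction c using Finset.strongInduction with
  | H c ih =>
    intro hc K G hG
    rw [directedValue_fiberwise, wker_eq _ _ hc, Finset.mul_sum, trainOp_sum]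
    refine sum_congr rfl fun b hb => ?_
    have hfib : ∀ o : Bool, ∑ x ∈ (dpieces c).filter (fun x => x.2 = ⟨b, o⟩), dvalue A f M z₀ K c G x
        = trainOp f (K * sideMat M b o * A⁻¹ * wker A⁻¹ (fun b => M b + (M b)ᵀ) (c.erase b)) G := by
      intro o
      rcases (c.erase b).eq_empty_or_nonempty with he | hne
      · have hcb : c = {b} := by rw [← insert_erase hb, he]; rfl
        rw [he, wker_empty, Matrix.mul_one, hcb]
        exact sum_fibre_singleton A f M z₀ h𝒞 hA b o K hG
      · rw [sum_fibre_eq_directedValue A f M z₀ h𝒞 hA hb hne o K hG,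
          ih (c.erase b) (erase_ssubset hb) hne _ hG]
    rw [Fintype.sum_bool, hfib, hfib, ← trainOp_add]
    congr 1
    simp only [sideMat, if_true, Bool.false_eq_true, if_false]
    noncomm_ring

/-- **THE PIECES ON A GROUP, SUMMED OVER THE SITES, ARE THE TRAIN OPERATOR**:
`Σ_{(D,π) ∈ pieces c} Σ_z (Π_{B∈π} w_B(z)) ∂_{C v_D(z)} G = ∂_{C𝔫(c)ℱ} G + ½ Σ_{p,q} (C𝔫(c))_{pq} ∂_p∂_q G`, the
train `δ/δΦ C □N_{b₁}□ C ⋯ □N_{b_k}□ C (½ δ/δΦ + ℱ)` summed over the walks through the vertices of `c`.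
[cite: BalabanImbrieJaffe1988, §5.13 p.306] -/
theorem sum_pieces_eq_trainOp {𝒞 : Submodule ℝ ((α → ℝ) → ℝ)} (h𝒞 : IsSmoothClass 𝒞) (hA : A.PosDef)
    {c : Finset (Finset I)} (hc : c.Nonempty) {G : (α → ℝ) → ℝ} (hG : G ∈ 𝒞) :
    ∑ q ∈ pieces Leg.blk c, ∑ z ∈ col z₀ c,
        (∏ B ∈ q.2, cweight A f (lv M z) B) • dset (fun l => A⁻¹ *ᵥ lv M z l) q.1 G
      = trainOp f (A⁻¹ * wker A⁻¹ (fun b => M b + (M b)ᵀ) c) G := by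
  rw [← directedValue_eq A f M z₀ h𝒞 hA c hc A⁻¹ hG, directedValue, dpieces, sum_sigma]
  refine sum_congr rfl fun q hq => ?_
  have hdir : ∀ (z : Finset I → α) (ls : Leg I), dir A M A⁻¹ z ls = fun l => A⁻¹ *ᵥ lv M z l := by
    intro z ls
    funext l
    rw [dir, ite_self]
  simp only [dvalue, hdir, sum_const]
  have hne : (q.1.card : ℝ) ≠ 0 := Nat.cast_ne_zero.2 (card_pos.2 (mem_pieces.1 hq).2.1).ne'
  rw [← Nat.cast_smul_eq_nsmul ℝ, smul_smul, mul_inv_cancel₀ hne, one_smul]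

end Induction

end Literature.MathematicalPhysics.QuantumFieldTheory.BalabanImbrieJaffe1984to88.BIJ88TrainPieces306
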